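import Summits.Ventures.HodgeRepro2.T5SU11SphericalLegendre

/-!
# Harish-Chandra's `c`-function of `SU(1,1)` in closed form: `c(λ) = Γ((1 − λ)/2) / (√π Γ(1 − λ/2))`

The `c`-function of the explicit model (`T5SU11SphericalAsymptotic`) is
`cfun λ = (2π)⁻¹ ∫_{-π}^{π} ((1 − cos φ)/2)^{-λ/2} dφ = (2/π) ∫_0^{π/2} sin^{-λ} θ dθ`, a Wallis-type
integral with a REAL exponent. We evaluate it through Mathlib's Beta function: the substitution
`u = sin² θ` on `[0, π/2]` (monotone, so `intervalIntegral.integral_comp_mul_deriv_of_deriv_nonneg`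
applies with NO hypothesis on the integrand) turns the real Beta integral
`∫_0^1 u^{a−1} (1 − u)^{b−1} du = Γ(a) Γ(b) / Γ(a + b)` (`integral_rpow_mul_one_sub_rpow`, the real
form of `Complex.betaIntegral_eq_Gamma_mul_div`) into
**`∫_0^{π/2} sin^p θ cos^q θ dθ = Γ((p+1)/2) Γ((q+1)/2) / (2 Γ((p+q)/2 + 1))`** for `p, q > −1`
(`integral_sin_rpow_mul_cos_rpow`), hence **Wallis for real exponents**
`∫_0^{π/2} sin^p θ dθ = √π Γ((p+1)/2) / (2 Γ(p/2 + 1))` (`integral_sin_rpow`, `integral_cos_rpow`),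
and finally **`c(λ) = Γ((1 − λ)/2) / (√π Γ(1 − λ/2))` for every `λ < 1`** (`cfun_eq_gamma`).
Sanity values: `c(0) = 1` (re-derived from the closed form), `c(−1) = 2/π`, `c(−2) = 1/2`
(`cfun_neg_one`, `cfun_neg_two`); and `c(−2) = 1/2` is CROSS-CHECKED against the rest of the chapter
(`cfun_neg_two_of_asymptotic`): by `T5SU11SphericalLegendre` `φ_{−2}(a_t) = cosh 2t`, so the asymptotic
`e^{λt} φ_λ(a_t) → c(λ)` of `T5SU11SphericalAsymptotic` at `λ = −2` reads `e^{-2t} cosh 2t → c(−2)`, and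
the elementary limit is `1/2`. The pole of `c` at the critical parameter `λ = 1` is the pole of
`Γ((1 − λ)/2)` at `0`, consistent with `c(λ) ≥ 1/(π(1 − λ))` of `T5SU11SphericalCfunLimit`. Nothing is
claimed about (N).

Blind lane: Mathlib + the HodgeRepro2 prefix only; no sorry; axioms ⊆ {propext, Classical.choice,
Quot.sound}.
-/

namespace Summit.Ventures.HodgeRepro2.T5SU11SphericalCfunClosed

open MeasureTheory Metric Set Filter Topology Complex intervalIntegral
open T5SU11Unimodular T5SU11Fibration T5SU11Cartan T5SU11OneParameter T5SU11CartanProjection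
  T5HaarCircle T5SU11SphericalFunction T5SU11SphericalTwo T5SU11SphericalAsymptotic
  T5SU11SphericalCfun T5SU11SphericalXiLog T5SU11SphericalLegendre
open scoped Real

/-! ### The real Beta integral -/

/-- **The real Beta integral**: `∫_0^1 x^{a−1} (1 − x)^{b−1} dx = Γ(a) Γ(b) / Γ(a + b)` for `a, b > 0`
(the real form of `Complex.betaIntegral_eq_Gamma_mul_div`). -/
theorem integral_rpow_mul_one_sub_rpow {a b : ℝ} (ha : 0 < a) (hb : 0 < b) :
    ∫ x in (0 : ℝ)..1, x ^ (a - 1) * (1 - x) ^ (b - 1)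
      = Real.Gamma a * Real.Gamma b / Real.Gamma (a + b) := by
  have h := Complex.betaIntegral_eq_Gamma_mul_div (a : ℂ) (b : ℂ) (by simpa using ha)
    (by simpa using hb)
  have hL : Complex.betaIntegral (a : ℂ) (b : ℂ)
      = ((∫ x in (0 : ℝ)..1, x ^ (a - 1) * (1 - x) ^ (b - 1) : ℝ) : ℂ) := by
    rw [Complex.betaIntegral, ← intervalIntegral.integral_ofReal]
    refine intervalIntegral.integral_congr fun x hx => ?_
    rw [uIcc_of_le zero_le_one] at hx
    have hx0 : 0 ≤ x := hx.1
    have hx1 : 0 ≤ 1 - x := by linarith [hx.2]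
    simp only [Complex.ofReal_mul, Complex.ofReal_cpow hx0, Complex.ofReal_cpow hx1,
      Complex.ofReal_sub, Complex.ofReal_one]
  rw [hL, ← Complex.ofReal_add, Complex.Gamma_ofReal, Complex.Gamma_ofReal,
    Complex.Gamma_ofReal] at h
  exact_mod_cast h

/-! ### The substitution `u = sin² θ` -/

/-- **The substitution `u = sin² θ` on `[0, π/2]`**, for EVERY `g : ℝ → ℝ` (no integrability or
continuity hypothesis — `intervalIntegral.integral_comp_mul_deriv_of_deriv_nonneg`, the substitution
being monotone): `∫_0^{π/2} g(sin² θ) · 2 sin θ cos θ dθ = ∫_0^1 g(u) du`. -/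
lemma integral_comp_sin_sq (g : ℝ → ℝ) :
    ∫ θ in (0 : ℝ)..(π / 2), g (Real.sin θ ^ 2) * (2 * Real.sin θ * Real.cos θ)
      = ∫ u in (0 : ℝ)..1, g u := by
  have hπ : 0 < π / 2 := by positivity
  have hf : ∀ θ ∈ Ioo (min (0 : ℝ) (π / 2)) (max (0 : ℝ) (π / 2)),
      HasDerivAt (fun θ => Real.sin θ ^ 2) (2 * Real.sin θ * Real.cos θ) θ := by
    intro θ _
    refine ((Real.hasDerivAt_sin θ).pow 2).congr_deriv ?_
    norm_num
  have hf' : ∀ θ ∈ Ioo (min (0 : ℝ) (π / 2)) (max (0 : ℝ) (π / 2)),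
      0 ≤ 2 * Real.sin θ * Real.cos θ := by
    intro θ hθ
    rw [min_eq_left hπ.le, max_eq_right hπ.le] at hθ
    have hs : 0 ≤ Real.sin θ :=
      Real.sin_nonneg_of_nonneg_of_le_pi hθ.1.le (by linarith [hθ.2, Real.pi_pos])
    have hc : 0 ≤ Real.cos θ :=
      (Real.cos_pos_of_mem_Ioo ⟨by linarith [hθ.1], hθ.2⟩).le
    positivity
  have hcont : ContinuousOn (fun θ => Real.sin θ ^ 2) (uIcc (0 : ℝ) (π / 2)) := by fun_prop
  have := intervalIntegral.integral_comp_mul_deriv_of_deriv_nonneg (g := g) hcont hf hf'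
  simpa [Real.sin_pi_div_two] using this

/-- The null set `{c}`: almost every real number differs from `c`. -/
lemma ae_ne (c : ℝ) : ∀ᵐ x ∂(volume : Measure ℝ), x ≠ c := by
  rw [ae_iff]
  simp only [not_not, Set.setOf_eq_eq_singleton]
  exact Real.volume_singleton

/-- On `(0, π/2)`: `(sin² θ)^{a−1} (1 − sin² θ)^{b−1} · 2 sin θ cos θ = 2 sin^{2a−1} θ cos^{2b−1} θ`. -/
lemma sin_sq_rpow_mul_eq {θ : ℝ} (h0 : 0 < θ) (h1 : θ < π / 2) (a b : ℝ) :
    (Real.sin θ ^ 2) ^ (a - 1) * (1 - Real.sin θ ^ 2) ^ (b - 1) * (2 * Real.sin θ * Real.cos θ)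
      = 2 * (Real.sin θ ^ (2 * a - 1) * Real.cos θ ^ (2 * b - 1)) := by
  have hs : 0 < Real.sin θ := Real.sin_pos_of_pos_of_lt_pi h0 (by linarith [Real.pi_pos])
  have hc : 0 < Real.cos θ := Real.cos_pos_of_mem_Ioo ⟨by linarith, h1⟩
  rw [← Real.cos_sq', ← Real.rpow_two, ← Real.rpow_two, ← Real.rpow_mul hs.le,
    ← Real.rpow_mul hc.le, show 2 * (a - 1) = (2 * a - 1) - 1 by ring,
    show 2 * (b - 1) = (2 * b - 1) - 1 by ring, Real.rpow_sub_one hs.ne',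
    Real.rpow_sub_one hc.ne']
  field_simp

/-! ### Wallis / Beta for real exponents -/

/-- **The Beta integral in trigonometric form, real exponents**: for `p, q > −1`,
`∫_0^{π/2} sin^p θ cos^q θ dθ = Γ((p+1)/2) Γ((q+1)/2) / (2 Γ((p+q)/2 + 1))`. -/
theorem integral_sin_rpow_mul_cos_rpow {p q : ℝ} (hp : -1 < p) (hq : -1 < q) :
    ∫ θ in (0 : ℝ)..(π / 2), Real.sin θ ^ p * Real.cos θ ^ q
      = Real.Gamma ((p + 1) / 2) * Real.Gamma ((q + 1) / 2)
          / (2 * Real.Gamma ((p + q) / 2 + 1)) := by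
  have ha : 0 < (p + 1) / 2 := by linarith
  have hb : 0 < (q + 1) / 2 := by linarith
  have hB := integral_rpow_mul_one_sub_rpow ha hb
  rw [← integral_comp_sin_sq (fun u => u ^ ((p + 1) / 2 - 1) * (1 - u) ^ ((q + 1) / 2 - 1))] at hB
  have hint : ∫ θ in (0 : ℝ)..(π / 2),
      (Real.sin θ ^ 2) ^ ((p + 1) / 2 - 1) * (1 - Real.sin θ ^ 2) ^ ((q + 1) / 2 - 1)
        * (2 * Real.sin θ * Real.cos θ)
      = 2 * ∫ θ in (0 : ℝ)..(π / 2), Real.sin θ ^ p * Real.cos θ ^ q := by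
    rw [← intervalIntegral.integral_const_mul]
    refine intervalIntegral.integral_congr_ae ?_
    filter_upwards [ae_ne (π / 2)] with θ hθ hθI
    rw [uIoc_of_le (by positivity)] at hθI
    have h1 : θ < π / 2 := lt_of_le_of_ne hθI.2 hθ
    rw [sin_sq_rpow_mul_eq hθI.1 h1, show 2 * ((p + 1) / 2) - 1 = p by ring,
      show 2 * ((q + 1) / 2) - 1 = q by ring]
  have hΓ : 0 < Real.Gamma ((p + q) / 2 + 1) := Real.Gamma_pos_of_pos (by linarith)
  rw [hint, show (p + 1) / 2 + (q + 1) / 2 = (p + q) / 2 + 1 by ring] at hB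
  rw [eq_div_iff (mul_pos two_pos hΓ).ne']
  rw [eq_div_iff hΓ.ne'] at hB
  linarith [hB]

/-- **Wallis for real exponents**: `∫_0^{π/2} sin^p θ dθ = √π Γ((p+1)/2) / (2 Γ(p/2 + 1))` for
`p > −1`. -/
theorem integral_sin_rpow {p : ℝ} (hp : -1 < p) :
    ∫ θ in (0 : ℝ)..(π / 2), Real.sin θ ^ p
      = √π * Real.Gamma ((p + 1) / 2) / (2 * Real.Gamma (p / 2 + 1)) := by
  have h := integral_sin_rpow_mul_cos_rpow hp (by norm_num : (-1 : ℝ) < 0)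
  simp only [Real.rpow_zero, mul_one, add_zero] at h
  rw [h, show (0 + 1 : ℝ) / 2 = 1 / 2 by norm_num, Real.Gamma_one_half_eq]
  ring

/-- **Wallis for real exponents, cosine form**: `∫_0^{π/2} cos^q θ dθ = √π Γ((q+1)/2) / (2 Γ(q/2 + 1))`
for `q > −1`. -/
theorem integral_cos_rpow {q : ℝ} (hq : -1 < q) :
    ∫ θ in (0 : ℝ)..(π / 2), Real.cos θ ^ q
      = √π * Real.Gamma ((q + 1) / 2) / (2 * Real.Gamma (q / 2 + 1)) := by
  have h := integral_sin_rpow_mul_cos_rpow (by norm_num : (-1 : ℝ) < 0) hq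
  simp only [Real.rpow_zero, one_mul, zero_add] at h
  rw [h, Real.Gamma_one_half_eq]

/-! ### The `c`-function in closed form -/

/-- `cLimit λ φ = sin(φ/2)^{-λ}` for `0 ≤ φ ≤ π`. -/
lemma cLimit_eq_sin_half_rpow (lam : ℝ) {φ : ℝ} (h0 : 0 ≤ φ) (h1 : φ ≤ π) :
    cLimit lam φ = Real.sin (φ / 2) ^ (-lam) := by
  have hs : 0 ≤ Real.sin (φ / 2) :=
    Real.sin_nonneg_of_nonneg_of_le_pi (by linarith) (by linarith)
  simp only [cLimit]
  rw [show (1 - Real.cos φ) / 2 = Real.sin (φ / 2) ^ 2 by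
        rw [Real.sin_sq_eq_half_sub, show 2 * (φ / 2) = φ by ring]; ring,
    ← Real.rpow_two, ← Real.rpow_mul hs]
  congr 1
  ring

/-- **`c(λ) = (2/π) ∫_0^{π/2} sin^{-λ} θ dθ`** for `λ < 1`. -/
theorem cfun_eq_integral_sin_rpow {lam : ℝ} (hlam : lam < 1) :
    cfun lam = 2 / π * ∫ θ in (0 : ℝ)..(π / 2), Real.sin θ ^ (-lam) := by
  have hπ : 0 < π := Real.pi_pos
  have hsymm : ∫ φ in (-π)..π, cLimit lam φ = 2 * ∫ φ in (0 : ℝ)..π, cLimit lam φ :=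
    integral_symm_of_even (fun φ => by simp only [cLimit, Real.cos_neg]) hπ.le
      (intervalIntegrable_cLimit hlam)
  have hpt : ∫ φ in (0 : ℝ)..π, cLimit lam φ = ∫ φ in (0 : ℝ)..π, Real.sin (φ / 2) ^ (-lam) := by
    refine intervalIntegral.integral_congr fun φ hφ => ?_
    rw [uIcc_of_le hπ.le] at hφ
    exact cLimit_eq_sin_half_rpow lam hφ.1 hφ.2
  have hsub : ∫ φ in (0 : ℝ)..π, Real.sin (φ / 2) ^ (-lam)
      = 2 * ∫ θ in (0 : ℝ)..(π / 2), Real.sin θ ^ (-lam) := by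
    have := intervalIntegral.integral_comp_div (f := fun θ => Real.sin θ ^ (-lam)) (a := 0) (b := π)
      (c := 2) two_ne_zero
    simpa [zero_div] using this
  rw [cfun, hsymm, hpt, hsub]
  field_simp

/-- **Harish-Chandra's `c`-function in closed form**:
`c(λ) = Γ((1 − λ)/2) / (√π Γ(1 − λ/2))` for every `λ < 1`. -/
theorem cfun_eq_gamma {lam : ℝ} (hlam : lam < 1) :
    cfun lam = Real.Gamma ((1 - lam) / 2) / (√π * Real.Gamma (1 - lam / 2)) := by
  have hπ : 0 < π := Real.pi_pos
  have hs : 0 < √π := Real.sqrt_pos.mpr hπ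
  have hsq : √π * √π = π := Real.mul_self_sqrt hπ.le
  have hΓ : 0 < Real.Gamma (1 - lam / 2) := Real.Gamma_pos_of_pos (by linarith)
  rw [cfun_eq_integral_sin_rpow hlam, integral_sin_rpow (by linarith),
    show (-lam + 1) / 2 = (1 - lam) / 2 by ring, show -lam / 2 + 1 = 1 - lam / 2 by ring,
    div_mul_div_comm, div_eq_div_iff (mul_pos hπ (mul_pos two_pos hΓ)).ne' (mul_pos hs hΓ).ne']
  linear_combination (2 * Real.Gamma ((1 - lam) / 2) * Real.Gamma (1 - lam / 2)) * hsq

/-- `c(0) = 1` re-derived from the closed form (`Γ(1/2) = √π`, `Γ(1) = 1`). -/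
theorem cfun_zero_of_gamma : cfun 0 = 1 := by
  rw [cfun_eq_gamma (by norm_num), show (1 - (0 : ℝ)) / 2 = 1 / 2 by norm_num,
    show (1 : ℝ) - 0 / 2 = 1 by norm_num, Real.Gamma_one_half_eq, Real.Gamma_one, mul_one,
    div_self (Real.sqrt_pos.mpr Real.pi_pos).ne']

/-- **`c(−1) = 2/π`** (`Γ(1) = 1`, `Γ(3/2) = √π/2`). -/
theorem cfun_neg_one : cfun (-1) = 2 / π := by
  have hπ : 0 < π := Real.pi_pos
  have hs : 0 < √π := Real.sqrt_pos.mpr hπ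
  have hsq : √π * √π = π := Real.mul_self_sqrt hπ.le
  have h32 : Real.Gamma (3 / 2) = √π / 2 := by
    rw [show (3 / 2 : ℝ) = 1 / 2 + 1 by norm_num, Real.Gamma_add_one (by norm_num),
      Real.Gamma_one_half_eq]
    ring
  rw [cfun_eq_gamma (by norm_num), show (1 - (-1 : ℝ)) / 2 = 1 by norm_num,
    show (1 : ℝ) - -1 / 2 = 3 / 2 by norm_num, Real.Gamma_one, h32]
  rw [div_eq_div_iff (by positivity) hπ.ne']
  linear_combination (-1 : ℝ) * hsq

/-- **`c(−2) = 1/2`** (`Γ(3/2) = √π/2`, `Γ(2) = 1`). -/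
theorem cfun_neg_two : cfun (-2) = 1 / 2 := by
  have hπ : 0 < π := Real.pi_pos
  have hs : 0 < √π := Real.sqrt_pos.mpr hπ
  have h32 : Real.Gamma (3 / 2) = √π / 2 := by
    rw [show (3 / 2 : ℝ) = 1 / 2 + 1 by norm_num, Real.Gamma_add_one (by norm_num),
      Real.Gamma_one_half_eq]
    ring
  have hs' : √π ≠ 0 := hs.ne'
  rw [cfun_eq_gamma (by norm_num), show (1 - (-2 : ℝ)) / 2 = 3 / 2 by norm_num,
    show (1 : ℝ) - -2 / 2 = 2 by norm_num, Real.Gamma_two, h32]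
  field_simp

/-! ### Cross-check against the asymptotic and `φ_{−2}(a_t) = cosh 2t` -/

/-- The elementary limit `e^{-2t} cosh 2t → 1/2`. -/
lemma tendsto_exp_neg_mul_cosh : Tendsto (fun t : ℝ => Real.exp (-2 * t) * Real.cosh (2 * t))
    atTop (𝓝 (1 / 2)) := by
  have h4 : Tendsto (fun t : ℝ => Real.exp (-(4 * t))) atTop (𝓝 0) :=
    Real.tendsto_exp_neg_atTop_nhds_zero.comp (tendsto_id.const_mul_atTop (by norm_num))
  have : Tendsto (fun t : ℝ => (1 + Real.exp (-(4 * t))) / 2) atTop (𝓝 ((1 + 0) / 2)) :=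
    (tendsto_const_nhds.add h4).div_const 2
  rw [add_zero] at this
  refine this.congr fun t => ?_
  rw [Real.cosh_eq]
  have e1 : Real.exp (-2 * t) * Real.exp (2 * t) = 1 := by
    rw [← Real.exp_add, show -2 * t + 2 * t = 0 by ring, Real.exp_zero]
  have e2 : Real.exp (-2 * t) * Real.exp (-(2 * t)) = Real.exp (-(4 * t)) := by
    rw [← Real.exp_add]; congr 1; ring
  calc (1 + Real.exp (-(4 * t))) / 2
      = (Real.exp (-2 * t) * Real.exp (2 * t) + Real.exp (-2 * t) * Real.exp (-(2 * t))) / 2 := by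
        rw [e1, e2]
    _ = Real.exp (-2 * t) * ((Real.exp (2 * t) + Real.exp (-(2 * t))) / 2) := by ring

section measure

variable [MeasurableSpace Circle] [BorelSpace Circle]

/-- **Cross-check**: `c(−2) = 1/2` re-derived from the asymptotic `e^{λt} φ_λ(a_t) → c(λ)`
(`tendsto_exp_mul_sph_hyp`) and the closed form `φ_{−2}(a_t) = cosh 2t` (`sph_neg_two_hyp`) — the
closed form of `c` is consistent with the rest of the chapter. -/
theorem cfun_neg_two_of_asymptotic : cfun (-2) = 1 / 2 := by
  have h1 := tendsto_exp_mul_sph_hyp (lam := -2) (by norm_num)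
  have h2 : Tendsto (fun t : ℝ => Real.exp (-2 * t) * sph (-2) (hyp t)) atTop (𝓝 (1 / 2)) := by
    refine tendsto_exp_neg_mul_cosh.congr fun t => ?_
    rw [sph_neg_two_hyp]
  exact tendsto_nhds_unique h1 h2

end measure

end Summit.Ventures.HodgeRepro2.T5SU11SphericalCfunClosed
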